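import Literature.AnabelianGeometry.EtaleTheta.Discharge.Sec2TemperedCoverDataModel
import Literature.AnabelianGeometry.SemiGraphs.TemperedCurveDiscreteRankOneWitness
import HarnessLib

/-!
# [EtTh] Lemma 2.17 (ii) as typed (`TemperedCoverData.Lem217_ii`): the universal closure over the
# interface `ThetaCovers.TemperedCoverData` FAILS at the NV-L2 model (FACT-LIST F-0606, schema row)

S. Mochizuki, *The étale theta function and its Frobenioid-theoretic manifestations*, Publ. RIMS **45**
(2009) [MochizukiEtTh2009], Lemma 2.17 (ii) p.58 (PDF): "for `Π` the tempered fundamental group of a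
hyperbolic orbicurve over a finite extension of `ℚ_p` and `H ⊆ Π` an open subgroup, `N_{Π̂}(H) = N_Π(H)`".
abc-iut cell, block F (fact-proving wave), seat abc-iut-f-142, FACT-LIST row **F-0606** (`Lem217_ii`,
trunk `ThetaCoversTempered.lean`, abc-iut-L2-t2).  PROOF-ONLY companion (0 definitions); the typed
statement is imported, never edited.

WHAT IS PROVED.  (1) Pure group theory over the interface: if the typed `T.Lem217_ii` holds and the
trivial subgroup of `Π^tp_C` is open (e.g. `Π^tp_C` discrete), then `Π^tp_C → Π_C` is SURJECTIVE
(`N_{Π_C}(1) = Π_C` while the image of `N_{Π^tp_C}(1) = Π^tp_C` is the range) — so the typed statement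
fails at every `T` whose `Π^tp_C` is discrete and countably infinite (`Π_C` compact: Baire,
`SemiGraphs.not_surjective_of_injective_of_compactSpace`, abc-iut-w6-d028).  (2) At the landed NV-L2 model
of abc-iut-w5-d118 («Heisenberg ⋊ D_l × Tate ℤ ⊆ Ẑ», `Discharge/Sec2TemperedCoverDataModel.lean`: `Π^tp_C =
A × ℤ` discrete, `Π_C = Â × Ẑ`; the structure literal of `TemperedModel.exists_model` is re-assembled
here from its public lemmas, nothing restated as a definition) `Π^tp_C → Π_C` is not onto, hence
`¬ T.Lem217_ii`; (3) `not_forall_lem217_ii : ¬ ∀ T : TemperedCoverData l, T.Lem217_ii` for every odd `l`.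

READING (honest label).  This is a SCHEMA verdict on the typed interface, not a claim about the printed
lemma: the interface `TemperedCoverData` does not force the tempered topology of `Π^tp_C` (the model's is
discrete), and Lemma 2.17 (ii) is an arithmetic-geometric input ([SemiAnbd] Thm 6.8 / André) that the
cone consumes BY NAME (`Lem217_ii_of_tower`, `Sec2DiscreteNormalizersHolds.lean`, gives it modulo
`IsTempered Π^tp_C` + the free normal subgroup tower).  no side taken on [IUTchIII] Cor 3.12; typed ≠ proved.
-/

noncomputable section

namespace Literature.AnabelianGeometry.EtaleTheta

namespace ThetaCovers

universe u

namespace TemperedCoverData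

variable {l : ℕ} (T : TemperedCoverData.{u} l)

/-- **The typed Lemma 2.17 (ii) forces `Π^tp_C ↠ Π_C` whenever `1 ⊆ Π^tp_C` is open**: apply
`T.Lem217_ii` to `H = ⊥`; `N_{Π_C}(⊥) = ⊤` and `N_{Π^tp_C}(⊥) = ⊤`, so `⊤ = range toHat`.
(Pure group theory over the interface.) [cite: MochizukiEtTh2009, Lem 2.17(ii) p.58] -/
theorem toHat_surjective_of_lem217_ii (h : T.Lem217_ii)
    (hopen : IsOpen ((⊥ : Subgroup T.Gtp) : Set T.Gtp)) : Function.Surjective T.toHat := by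
  have key := h ⊥ hopen
  rw [Subgroup.map_bot, Subgroup.normalizer_eq_top, Subgroup.normalizer_eq_top,
    ← MonoidHom.range_eq_map] at key
  exact MonoidHom.range_eq_top.mp key.symm

/-- Contrapositive: a `T` with DISCRETE `Π^tp_C` and non-surjective `Π^tp_C → Π_C` violates the typed
Lemma 2.17 (ii). [cite: MochizukiEtTh2009, Lem 2.17(ii) p.58] -/
theorem not_lem217_ii_of_not_surjective [DiscreteTopology T.Gtp]
    (hns : ¬ Function.Surjective T.toHat) : ¬ T.Lem217_ii := fun h =>
  hns (T.toHat_surjective_of_lem217_ii h (isOpen_discrete _))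

/-- **No `T` with discrete, countably infinite `Π^tp_C` satisfies the typed Lemma 2.17 (ii)**: `Π_C` is
compact Hausdorff (`isProfiniteCompletion_toHat`) and `Π^tp_C → Π_C` injective (`injective_toHat`), and an
injective homomorphism from a countably infinite group into a compact Hausdorff group is never onto
(Baire; `SemiGraphs.not_surjective_of_injective_of_compactSpace`, abc-iut-w6-d028).
[cite: MochizukiEtTh2009, Lem 2.17(ii) p.58] -/
theorem not_lem217_ii_of_countable_of_infinite [DiscreteTopology T.Gtp] [Countable T.Gtp]
    [Infinite T.Gtp] : ¬ T.Lem217_ii := by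
  haveI : CompactSpace T.PiC := T.isProfiniteCompletion_toHat.compactSpace
  haveI : T2Space T.PiC := T.isProfiniteCompletion_toHat.t2Space
  exact T.not_lem217_ii_of_not_surjective
    (Literature.AnabelianGeometry.SemiGraphs.not_surjective_of_injective_of_compactSpace
      (⟨T.toHat, T.continuous_toHat⟩ : T.Gtp →ₜ* T.PiC) T.injective_toHat)

end TemperedCoverData

namespace TemperedModel

open Multiplicative HeisenbergWitness Literature.AnabelianGeometry.SemiGraphs
  Literature.AnabelianGeometry.EtaleTheta.SettingModel

variable (l : ℕ) [NeZero l]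

/-- **`Π^tp_C = A × ℤ → Π_C = Â × Ẑ` is NOT surjective** in the NV-L2 model (`A × ℤ` is countably
infinite and discrete, `Â × Ẑ` compact Hausdorff, the map injective: Baire). (toy bookkeeping)
[cite: MochizukiEtTh2009, Def 2.5 p.39] -/
theorem toHatM_not_surjective : ¬ Function.Surjective (toHatM l) := by
  haveI : Countable (Multiplicative ℤ) := inferInstanceAs (Countable ℤ)
  haveI : Infinite (GtpM l) := Prod.infinite_of_right
  exact not_surjective_of_injective_of_compactSpace (toHatM l) (toHatM_injective l)

/-- **THE NV-L2 MODEL VIOLATES THE TYPED Lemma 2.17 (ii).**  For every odd `l` there is a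
`T : ThetaCovers.TemperedCoverData l` — abc-iut-w5-d118's model «Heisenberg ⋊ D_l × Tate ℤ ⊆ Ẑ», `G_K = 1`,
the SAME structure literal as in `TemperedModel.exists_model` — with `K ⊇ μ_l` (`HasMuL`), `Π^tp_C`
discrete, `Π^tp_C → Π_C` not surjective, and `¬ T.Lem217_ii` (witness `H = ⊥`: `N_{Π_C}(1) = Π_C ⊋
Π^tp_C = N_{Π^tp_C}(1)`).  CONSISTENCY/INDEPENDENCE certificate only: the interface does not force the
tempered topology. [cite: MochizukiEtTh2009, Lem 2.17(ii) p.58] -/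
theorem exists_model_not_lem217_ii (hl : Odd l) : ∃ T : TemperedCoverData.{0} l,
    T.HasMuL ∧ DiscreteTopology T.Gtp ∧ ¬ Function.Surjective T.toHat ∧ ¬ T.Lem217_ii := by
  haveI := TAX_normal l
  haveI : ((TAX l).prod (⊥ : Subgroup (Multiplicative ℤ))).Normal := Subgroup.prod_normal _ _
  let T : TemperedCoverData.{0} l :=
    { toCoverDataAx := coverDataAx l hl
      PiCuu := PiCuuM l
      isTypeLTorsThetaPm := isTypeLTorsThetaPm_PiCuuM l hl
      isOpen_PiCuu' := isOpen_PiCuuM l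
      Gtp := GtpM l
      toHat := (toHatM l).toMonoidHom
      continuous_toHat := (toHatM l).continuous
      injective_toHat := toHatM_injective l
      isProfiniteCompletion_toHat := isProfiniteCompletion_prodMap_etaCont (TA l) (Multiplicative ℤ)
      PiYtp := (TAX l).prod ⊥
      PiYtp_le := by
        change (TAX l).prod ⊥ ≤ (PiXM l).comap (toHatM l).toMonoidHom
        rw [comap_toHatM_PiXM]
        exact Subgroup.prod_mono le_rfl bot_le
      PiYtp_normal := inferInstance
      isOpen_PiYtp := isOpen_discrete _
      quotZ := nonempty_quotZ l
      PiYddtp := ((TAX l ⊓ (TA.two l).ker)).prod ⊥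
      PiYddtp_le := Subgroup.prod_mono inf_le_left le_rfl
      isOpen_PiYddtp := isOpen_discrete _
      relIndex_PiYddtp := relIndex_PiYddtp l
      PiCdot := ((TA.two l).ker).prod ⊤
      index_PiCdot := index_PiCdot l
      isOpen_PiCdot := isOpen_discrete _
      PiCdot_ne := PiCdot_ne l }
  have hd : DiscreteTopology T.Gtp := inferInstanceAs (DiscreteTopology (GtpM l))
  have hns : ¬ Function.Surjective T.toHat := toHatM_not_surjective l
  exact ⟨T, fun c t ht => hasMuL_model l hl c ht, hd, hns,
    @TemperedCoverData.not_lem217_ii_of_not_surjective l T hd hns⟩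

/-- **FACT-LIST F-0606 (`Lem217_ii`), SCHEMA VERDICT: the universal closure of the typed [EtTh]
Lemma 2.17 (ii) over `ThetaCovers.TemperedCoverData l` is FALSE for every odd `l`** — it fails at the
NV-L2 model.  The row stays a BY-NAME input of the cone (conditional reduction of record:
`TemperedCoverData.Lem217_ii_of_tower`). [cite: MochizukiEtTh2009, Lem 2.17(ii) p.58] -/
theorem not_forall_lem217_ii (hl : Odd l) : ¬ ∀ T : TemperedCoverData.{0} l, T.Lem217_ii := by
  obtain ⟨T, -, -, -, hT⟩ := exists_model_not_lem217_ii l hl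
  exact fun h => hT (h T)

/-- The same at the printed parity-free smallest instance `l = 3` (a closed statement, no hypotheses).
[cite: MochizukiEtTh2009, Lem 2.17(ii) p.58] -/
theorem not_forall_lem217_ii_three : ¬ ∀ T : TemperedCoverData.{0} 3, T.Lem217_ii :=
  not_forall_lem217_ii 3 ⟨1, rfl⟩

end TemperedModel

end ThetaCovers

end Literature.AnabelianGeometry.EtaleTheta
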